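import Mathlib
import HarnessLib
import Summits.Ventures.LatticeQCDFlow.Exactness.SU2KickJacobian
import Summits.Ventures.LatticeQCDFlow.Exactness.SphereKickSweep

/-!
# The `SU(2)` kick with an everywhere-POSITIVE Jacobian density (the poles repaired on a null set), jointly measurable in (field, link) — the form the coupling-layer and FT-HMC theorems consume

HONEST FRAMING: exact (Metropolis-corrected) sampling algorithms for lattice gauge theory;
figures of merit are autocorrelation/cost numbers at stated couplings and volumes; no
continuum-physics claim.

Venture `LatticeQCDFlow` (cell pub-lqcd), topic `Exactness`; FANOUT row 14 (`eng-flowhmc`, engine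
`latflow.fthmc`, family B; `SU(2)` rung).  NEW WORK of the cell; nothing is cited as a fact; no
number.  `SU2KickJacobian.hasJacobian_su2Kick` certifies the kick `U ↦ gaussUnit (geodesicKick c J
(vecQuat U))` for `haarProbability SU(2)` with row 7's printed density
`kickJac κ 2 θ = (1 − κ cos θ)(sin(θ − κ sin θ)/sin θ)²`, `κ = c‖J‖`, `θ = angle J (vecQuat U)`.
Two things are still needed downstream (`Theory2.hasJacobian_coupleFun`, `thmc_exact`,
`gauge_fthmc_leapfrog_config_exact`): the density must be POSITIVE EVERYWHERE (it enters
`log J` of the pulled-back Hamiltonian) — but Lean's `0/0 = 0` makes `kickJac` vanish at the two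
poles `θ ∈ {0, π}`, where the true (continuous) value is `(1 − κ cos θ)³` — and it must be
JOINTLY measurable in the local field and the link.  Here:

* `continuous_vecQuat_coe` (and row 7's `SphereKickSweep.continuous_geodesicKick₂`,
  `measurable_kickJac₂`, `measurable_angle₂`, reused) — joint continuity / measurability.
* `toSphere_R4_singleton` — points are null for the surface measure of `S³` (the cone over a
  point lies in a line); `toSphere_sin_angle_eq_zero` — so is the set where `sin (angle J ·)`
  vanishes (`⊆ {±Ĵ}`; empty for `J = 0`, where the angle is `π/2`).
* The repaired density `θ ↦ if sin θ = 0 then (1 − κ cos θ)³ else kickJac κ 2 θ` (an explicit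
  expression, no definition): `kickJacFix_pos` (positive on `[0, π]` for `|κ| < 1`),
  `measurable_kickJacFix₂`.
* `measurable_su2Kick₂`, `measurable_su2KickJacFix₂` — joint measurability in (link, field).
* **`hasJacobian_su2Kick_fix`** — for `|c| ‖J‖ ≤ 1` the kick has `HasJacobian (haarProbability
  SU(2))` with the REPAIRED density (transport of row 7's certificate along `gaussUnit` with an
  almost-everywhere identification, `HasJacobian.of_semiconj`); `su2KickJacFix_pos` — which is
  positive everywhere as soon as `|c| ‖J‖ < 1`.

NOT here: the lattice (next file `SU2WilsonFlowLOSubstep`); `SU(N ≥ 3)`; any number.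
-/

noncomputable section

namespace Summit.Ventures.LatticeQCDFlow.Exactness

open Real Set MeasureTheory Measure InnerProductGeometry Metric
open Literature.MathematicalPhysics.QuantumFieldTheory (haarProbability)
open scoped ENNReal Pointwise

/-! ## Joint continuity and measurability -/

section Joint

/-- The quaternion coordinates of an `SU(2)` element depend continuously on it. -/
theorem continuous_vecQuat_coe :
    Continuous fun U : Matrix.specialUnitaryGroup (Fin 2) ℂ => vecQuat (U : Matrix (Fin 2) (Fin 2) ℂ) :=
  continuous_vecQuat.comp continuous_subtype_val

end Joint

/-! ## Points are null on `S³`; so is the pole set of the angle -/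

section Null

/-- A point of `S³` is null for the surface measure: the cone over it lies in a line of `ℝ⁴`. -/
theorem toSphere_R4_singleton (x : sphere (0 : R4) 1) :
    (volume : Measure R4).toSphere {x} = 0 := by
  rw [Measure.toSphere_apply' _ (measurableSet_singleton x), Set.image_singleton]
  have hsub : Set.Ioo (0 : ℝ) 1 • ({(x : R4)} : Set R4) ⊆ (Submodule.span ℝ {(x : R4)} : Set R4) := by
    rintro _ ⟨r, -, y, hy, rfl⟩
    rw [Set.mem_singleton_iff.mp hy]
    exact Submodule.smul_mem _ _ (Submodule.subset_span rfl)
  have hspan : (Submodule.span ℝ {(x : R4)}) ≠ ⊤ := by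
    intro h
    have h1 : Module.finrank ℝ (Submodule.span ℝ {(x : R4)}) = 1 :=
      finrank_span_singleton (sphere_coe_ne_zero x)
    rw [h, finrank_top, finrank_euclideanSpace_fin] at h1
    norm_num at h1
  rw [measure_mono_null hsub (Measure.addHaar_submodule volume _ hspan), mul_zero]

/-- The set where `sin (angle J ·)` vanishes is null on `S³` (it is empty for `J = 0` and
`⊆ {±J/‖J‖}` otherwise). -/
theorem toSphere_sin_angle_eq_zero (J : R4) :
    (volume : Measure R4).toSphere {x : sphere (0 : R4) 1 | sin (angle J (x : R4)) = 0} = 0 := by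
  rcases eq_or_ne J 0 with rfl | hJ
  · have h : {x : sphere (0 : R4) 1 | sin (angle (0 : R4) (x : R4)) = 0} = ∅ := by
      ext x
      simp only [angle_zero_left, sin_pi_div_two, one_ne_zero, mem_setOf_eq, mem_empty_iff_false]
    rw [h, measure_empty]
  · have hJn : 0 < ‖J‖ := norm_pos_iff.2 hJ
    set xp : sphere (0 : R4) 1 := ⟨‖J‖⁻¹ • J, by
      rw [mem_sphere_zero_iff_norm, norm_smul, norm_inv, norm_norm, inv_mul_cancel₀ hJn.ne']⟩
    set xm : sphere (0 : R4) 1 := ⟨-(‖J‖⁻¹ • J), by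
      rw [mem_sphere_zero_iff_norm, norm_neg, norm_smul, norm_inv, norm_norm,
        inv_mul_cancel₀ hJn.ne']⟩
    have hsub : {x : sphere (0 : R4) 1 | sin (angle J (x : R4)) = 0} ⊆ {xp, xm} := by
      intro x hx
      have hx1 : ‖(x : R4)‖ = 1 := norm_eq_of_mem_sphere x
      rw [mem_setOf_eq] at hx
      -- `sin θ = 0` forces `|cos θ| = 1`, i.e. `x` is collinear with `J`
      have hcos : |inner ℝ J (x : R4) / (‖J‖ * ‖(x : R4)‖)| = 1 := by
        rw [← InnerProductGeometry.cos_angle]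
        have h2 : cos (angle J (x : R4)) ^ 2 = 1 ^ 2 := by
          nlinarith [sin_sq_add_cos_sq (angle J (x : R4)), hx]
        simpa using (sq_eq_sq_iff_abs_eq_abs _ _).1 h2
      obtain ⟨-, r, hr0, hxr⟩ := (abs_real_inner_div_norm_mul_norm_eq_one_iff J (x : R4)).1 hcos
      have hr : |r| = ‖J‖⁻¹ := by
        have h3 : |r| * ‖J‖ = 1 := by rw [← hx1, hxr, norm_smul, Real.norm_eq_abs]
        field_simp
        linarith [h3]
      rcases (abs_eq (inv_pos.2 hJn).le).1 hr with h | h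
      · left
        exact Subtype.ext (by rw [hxr, h])
      · right
        rw [mem_singleton_iff]
        exact Subtype.ext (by rw [hxr, h, neg_smul])
    have h0 : (volume : Measure R4).toSphere {xp, xm} = 0 := by
      rw [Set.insert_eq]
      exact measure_union_null (toSphere_R4_singleton xp) (toSphere_R4_singleton xm)
    exact measure_mono_null hsub h0

end Null

/-! ## The repaired density: positive, jointly measurable -/

section Fix

/-- **The repaired per-link density is positive on `[0, π]` for `|κ| < 1`**: at the poles it is
`(1 − κ cos θ)³ ≥ (1 − |κ|)³ > 0`, in the interior it is row 7's `kickJac_pos`. -/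
theorem kickJacFix_pos {κ : ℝ} (hκ : |κ| < 1) {θ : ℝ} (hθ : θ ∈ Icc 0 π) :
    0 < (if sin θ = 0 then (1 - κ * cos θ) ^ 3 else kickJac κ 2 θ) := by
  split_ifs with hs
  · have h1 : |κ * cos θ| ≤ |κ| := by
      rw [abs_mul]
      exact mul_le_of_le_one_right (abs_nonneg κ) (abs_cos_le_one θ)
    have h2 : κ * cos θ < 1 := lt_of_le_of_lt (le_abs_self _) (lt_of_le_of_lt h1 hκ)
    have h3 : 0 < 1 - κ * cos θ := by linarith
    positivity
  · refine kickJac_pos hκ 2 ⟨lt_of_le_of_ne hθ.1 ?_, lt_of_le_of_ne hθ.2 ?_⟩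
    · intro h
      exact hs (by rw [← h, sin_zero])
    · intro h
      exact hs (by rw [h, sin_pi])

/-- The repaired density is jointly measurable in (`κ`, angle). -/
theorem measurable_kickJacFix₂ : Measurable fun p : ℝ × ℝ =>
    if sin p.2 = 0 then (1 - p.1 * cos p.2) ^ 3 else kickJac p.1 2 p.2 := by
  refine Measurable.ite ?_ ?_ (measurable_kickJac₂ 2)
  · exact measurableSet_eq_fun (continuous_sin.measurable.comp measurable_snd) measurable_const
  · fun_prop

end Fix

/-! ## The kick on `SU(2)` with the repaired density -/

section Kick

variable {c : ℝ} {J : R4}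

/-- **The `SU(2)` kick with the repaired, everywhere-positive density is certified for the Haar
probability measure** (`|c| ‖J‖ ≤ 1`): the repaired density differs from row 7's only on the
preimage of `{±Ĵ}`, a Haar-null set. -/
theorem hasJacobian_su2Kick_fix (hc : |c| * ‖J‖ ≤ 1) :
    HasJacobian (haarProbability (Matrix.specialUnitaryGroup (Fin 2) ℂ))
      (fun U : Matrix.specialUnitaryGroup (Fin 2) ℂ =>
        gaussUnit (geodesicKick c J (vecQuat (U : Matrix (Fin 2) (Fin 2) ℂ))))
      fun U => ENNReal.ofReal
        (if sin (angle J (vecQuat (U : Matrix (Fin 2) (Fin 2) ℂ))) = 0 then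
          (1 - c * ‖J‖ * cos (angle J (vecQuat (U : Matrix (Fin 2) (Fin 2) ℂ)))) ^ 3
        else kickJac (c * ‖J‖) 2 (angle J (vecQuat (U : Matrix (Fin 2) (Fin 2) ℂ)))) := by
  have hsph := hasJacobian_sphereKick' 2 finrank_R4 (volume : Measure R4) hc
  have hF : Measurable fun U : Matrix.specialUnitaryGroup (Fin 2) ℂ =>
      gaussUnit (geodesicKick c J (vecQuat (U : Matrix (Fin 2) (Fin 2) ℂ))) :=
    measurable_gaussUnit.comp ((continuous_geodesicKick c J).comp continuous_vecQuat_coe).measurable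
  have hj : Measurable fun U : Matrix.specialUnitaryGroup (Fin 2) ℂ => ENNReal.ofReal
      (if sin (angle J (vecQuat (U : Matrix (Fin 2) (Fin 2) ℂ))) = 0 then
          (1 - c * ‖J‖ * cos (angle J (vecQuat (U : Matrix (Fin 2) (Fin 2) ℂ)))) ^ 3
        else kickJac (c * ‖J‖) 2 (angle J (vecQuat (U : Matrix (Fin 2) (Fin 2) ℂ)))) :=
    (measurable_kickJacFix₂.comp (measurable_const.prodMk
      ((measurable_angle_right J).comp continuous_vecQuat_coe.measurable))).ennreal_ofReal
  have hae : (fun x : sphere (0 : R4) 1 => ENNReal.ofReal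
      (if sin (angle J (vecQuat (gaussUnit (x : R4) : Matrix (Fin 2) (Fin 2) ℂ))) = 0 then
          (1 - c * ‖J‖ * cos (angle J (vecQuat (gaussUnit (x : R4) : Matrix (Fin 2) (Fin 2) ℂ)))) ^ 3
        else kickJac (c * ‖J‖) 2
          (angle J (vecQuat (gaussUnit (x : R4) : Matrix (Fin 2) (Fin 2) ℂ)))))
      =ᵐ[(volume : Measure R4).toSphere]
      fun x => ENNReal.ofReal (kickJac (c * ‖J‖) 2 (angle J (x : R4))) := by
    have hmem : {x : sphere (0 : R4) 1 | sin (angle J (x : R4)) = 0}ᶜ ∈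
        ae ((volume : Measure R4).toSphere) := compl_mem_ae_iff.2 (toSphere_sin_angle_eq_zero J)
    filter_upwards [hmem] with x hx
    rw [mem_compl_iff, mem_setOf_eq] at hx
    simp only [vecQuat_gaussUnit_sphere, if_neg hx]
  have h := HasJacobian.of_semiconj (ρ := (volume : Measure R4).toSphere)
    measurable_gaussUnit_sphere hsph hF hj
    (Filter.Eventually.of_forall fun x => su2Kick_gaussUnit c J x) hae
  rw [map_gaussUnit_toSphere] at h
  have h' := h.smul ((volume : Measure R4).toSphere univ)⁻¹
  rwa [smul_smul, ENNReal.inv_mul_cancel toSphere_R4_univ_ne_zero toSphere_R4_univ_ne_top,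
    one_smul] at h'

/-- The repaired density of the `SU(2)` kick is positive everywhere for `|c| ‖J‖ < 1`. -/
theorem su2KickJacFix_pos (hc : |c| * ‖J‖ < 1) (U : Matrix.specialUnitaryGroup (Fin 2) ℂ) :
    0 < (if sin (angle J (vecQuat (U : Matrix (Fin 2) (Fin 2) ℂ))) = 0 then
          (1 - c * ‖J‖ * cos (angle J (vecQuat (U : Matrix (Fin 2) (Fin 2) ℂ)))) ^ 3
        else kickJac (c * ‖J‖) 2 (angle J (vecQuat (U : Matrix (Fin 2) (Fin 2) ℂ)))) := by
  have hκ : |c * ‖J‖| < 1 := by rwa [abs_mul, abs_norm]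
  exact kickJacFix_pos hκ ⟨angle_nonneg _ _, angle_le_pi _ _⟩

/-- The `SU(2)` kick is jointly measurable in (link, local field). -/
theorem measurable_su2Kick₂ (c : ℝ) :
    Measurable fun q : (Matrix.specialUnitaryGroup (Fin 2) ℂ) × R4 =>
      gaussUnit (geodesicKick c q.2 (vecQuat ((q.1 : Matrix.specialUnitaryGroup (Fin 2) ℂ) : Matrix (Fin 2) (Fin 2) ℂ))) := by
  have hfun : (fun q : (Matrix.specialUnitaryGroup (Fin 2) ℂ) × R4 =>
      gaussUnit (geodesicKick c q.2 (vecQuat ((q.1 : Matrix.specialUnitaryGroup (Fin 2) ℂ) : Matrix (Fin 2) (Fin 2) ℂ)))) =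
      gaussUnit ∘ (fun p : R4 × R4 => geodesicKick c p.1 p.2) ∘
        (fun q : (Matrix.specialUnitaryGroup (Fin 2) ℂ) × R4 => (q.2, vecQuat ((q.1 : Matrix.specialUnitaryGroup (Fin 2) ℂ) : Matrix (Fin 2) (Fin 2) ℂ))) := by
    funext q
    simp only [Function.comp_apply]
  rw [hfun]
  exact measurable_gaussUnit.comp ((continuous_geodesicKick₂ (V := R4) c).measurable.comp
    (measurable_snd.prodMk (continuous_vecQuat_coe.measurable.comp measurable_fst)))

/-- The repaired density of the `SU(2)` kick is jointly measurable in (link, local field). -/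
theorem measurable_su2KickJacFix₂ (c : ℝ) :
    Measurable fun q : (Matrix.specialUnitaryGroup (Fin 2) ℂ) × R4 =>
      (if sin (angle q.2 (vecQuat ((q.1 : Matrix.specialUnitaryGroup (Fin 2) ℂ) : Matrix (Fin 2) (Fin 2) ℂ))) = 0 then
          (1 - c * ‖q.2‖ * cos (angle q.2 (vecQuat ((q.1 : Matrix.specialUnitaryGroup (Fin 2) ℂ) : Matrix (Fin 2) (Fin 2) ℂ)))) ^ 3
        else kickJac (c * ‖q.2‖) 2 (angle q.2 (vecQuat ((q.1 : Matrix.specialUnitaryGroup (Fin 2) ℂ) : Matrix (Fin 2) (Fin 2) ℂ)))) := by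
  have hang : Measurable fun q : (Matrix.specialUnitaryGroup (Fin 2) ℂ) × R4 => angle q.2 (vecQuat ((q.1 : Matrix.specialUnitaryGroup (Fin 2) ℂ) : Matrix (Fin 2) (Fin 2) ℂ)) := by
    have hfun : (fun q : (Matrix.specialUnitaryGroup (Fin 2) ℂ) × R4 => angle q.2 (vecQuat ((q.1 : Matrix.specialUnitaryGroup (Fin 2) ℂ) : Matrix (Fin 2) (Fin 2) ℂ))) =
        (fun p : R4 × R4 => angle p.1 p.2) ∘
          (fun q : (Matrix.specialUnitaryGroup (Fin 2) ℂ) × R4 => (q.2, vecQuat ((q.1 : Matrix.specialUnitaryGroup (Fin 2) ℂ) : Matrix (Fin 2) (Fin 2) ℂ))) := by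
      funext q
      simp only [Function.comp_apply]
    rw [hfun]
    exact measurable_angle₂.comp
      (measurable_snd.prodMk (continuous_vecQuat_coe.measurable.comp measurable_fst))
  have hfun : (fun q : (Matrix.specialUnitaryGroup (Fin 2) ℂ) × R4 =>
      (if sin (angle q.2 (vecQuat ((q.1 : Matrix.specialUnitaryGroup (Fin 2) ℂ) : Matrix (Fin 2) (Fin 2) ℂ))) = 0 then
          (1 - c * ‖q.2‖ * cos (angle q.2 (vecQuat ((q.1 : Matrix.specialUnitaryGroup (Fin 2) ℂ) : Matrix (Fin 2) (Fin 2) ℂ)))) ^ 3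
        else kickJac (c * ‖q.2‖) 2 (angle q.2 (vecQuat ((q.1 : Matrix.specialUnitaryGroup (Fin 2) ℂ) : Matrix (Fin 2) (Fin 2) ℂ))))) =
      (fun p : ℝ × ℝ => if sin p.2 = 0 then (1 - p.1 * cos p.2) ^ 3 else kickJac p.1 2 p.2) ∘
        (fun q : (Matrix.specialUnitaryGroup (Fin 2) ℂ) × R4 => (c * ‖q.2‖, angle q.2 (vecQuat ((q.1 : Matrix.specialUnitaryGroup (Fin 2) ℂ) : Matrix (Fin 2) (Fin 2) ℂ)))) := by
    funext q
    simp only [Function.comp_apply]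
  rw [hfun]
  exact measurable_kickJacFix₂.comp ((measurable_const.mul measurable_snd.norm).prodMk hang)

end Kick

end Summit.Ventures.LatticeQCDFlow.Exactness
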